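import Mathlib.NumberTheory.LegendreSymbol.JacobiSymbol
import Summits.ABC.ABC.Theses.DefiniteXi
import Summits.ABC.ABC.Theorems.XiBound.Negative.XiBoundDomainSetup
import Literature.NumberTheory.Automorphic.BrandtXiSetupIndependence
import Literature.NumberTheory.Automorphic.DefiniteOrderUnitsFinite

/-!
# Line `theta-content-squeeze` for the crux `DefiniteXi.XiBound` (stmt-ABC-11336)

Crux (route `ABC/DefiniteXi`, rank 2): `XiBound` — `∃ A C, ξ(E_(a,b); N/N⁻, N⁻) ≤ C·N^A` for every
Frey curve and admissible `N⁻`, `ξ = brandtXi = Σ_c w_c φ_c²` the Gross norm of the primitive generator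
`φ` of the `a(E)`-eigen-line of the Brandt module `X = ℤ[Cls O]`.

**Idea (card `Cruxes/XiBound/Ideas/theta-content-squeeze.md`).**  `X` carries ONE integral structure
and it is self-dual, so every identity native to `X` is homogeneous in `φ`.  Import the only other
integral model of the eigen-system that does not pass through `X₀(N)`: the ternary theta series of the
Gross lattices `R^T = (ℤ + 2R) ∩ {trd = 0}` of the left orders `R` of the ideal classes (Gross 1987 §12,
Böcherer–Schulze-Pillot 1990/91).  For ANY `ℤ`-linear `Θ : X → ℤ^κ` mapping `φ^{⊥_w}` into a sublattice
`ℚ`-disjoint from `Θφ ≠ 0` one has the functoriality of congruence exponents (proved below,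
`xi_dvd_congrExponent_mul_content`; the card's first lemma, made canonical):

  `ξ ∣ η₀ · c · γ`,  `c = content(Θφ)`, `η₀ =` exponent of `Θ(X)/(ℤ·Θφ/c ⊕ Θ(φ^⊥))`, `γ = gcd_c(w_c φ_c)`,

and `η₀ ≤ ξ` always (`congrExponent_le`).  With the weights bounded (`γ² ≤ w_max·ξ`) this gives
`ξ ≤ w_max · (η₀ c)²` (`sum_le_of_dvd`), so a polynomial bound on `ξ` follows from polynomial bounds on
the THETA CONTENT `c` (stub `ThetaContentBound`, T1) and on the weight-3/2 CONGRUENCE EXPONENT `η₀`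
(stub `ThetaCongruenceExponentBound`, T2 — the load-bearing, abc-strength stub), once `Θφ ≠ 0` with a
non-zero coefficient of polynomial index (stub `ThetaNonvanishing`, NV) and the seam holds (stub
`ThetaSeam`, S: Eichler's commutation relation `T(p) ↔ T_{p²}` + strong multiplicity one, stated as plain
`ℚ`-disjointness of truncated integer vectors — no half-integral weight modular form, absent from
Mathlib, is needed anywhere in this file).

**Two devices that make NV honest.**  (1) The plain theta lift of `φ_f` vanishes identically iff
`L(f,1) = 0` (Waldspurger; Gross; B–SP) — half of the Frey family.  The line therefore squeezes the
line of the QUADRATIC TWIST `f ⊗ χ_t` (`χ_t = (·/t)`, `t ∤ 2N` an auxiliary prime with `L(f⊗χ_t,1) ≠ 0`,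
polynomially small by Friedberg–Hoffstein + first moments) in the Brandt module of type `(N⁺t², N⁻)`
— an honest instance of the tree's `brandtXi` — and transfers back by the known-type stub
`TwistTransfer` (TT: `ξ(f) ≤ C(Nt)^A ξ(f⊗χ_t)`, modular degrees of twists).  (2) The test vector: the
theta map is taken through an auxiliary SUB-ORDER `O' ⊆ O` of polynomially bounded index
(`Θ_{S,O'} = Θ_{O'} ∘ ρ^!`, `ρ^!` the pull-back of divisors with multiplicity along `Cls O' → Cls O`),
so that at the primes `2` (additive reduction of Frey curves) and `t` (level `t²`), where the Gross
lattice of the Eichler order itself is not known to be a good test vector, the prover may change the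
local Schwartz function; every `π_v` lifts locally, so NV reduces to `L(f⊗χ_t,1) ≠ 0` plus local
test-vector computations (flagged as the line's definition risk).

**Design.**  Everything is CONCRETE: `thetaMap S O' B : (Cls O → ℤ) →ₗ[ℤ] (Fin B → ℤ)` is defined from
tree primitives (`Brandt.leftOrder`, `Brandt.ClassSet.rep`, `Brandt.weight`, `reducedTrace ℚ`,
`reducedNorm ℚ`, pointwise `Dˣ`-action); stubs are CONSEQUENCE-level statements (disjointness,
non-vanishing, bounds with `ℕ` constants), so normalisation conventions cannot falsify them; `η₀` is taken
inside the theta IMAGE (not inside an ambient space of forms), so `η₀ ≤ ξ` unconditionally and the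
squeeze is worth exactly the theta content.  Composition `XiBound_of`: NV picks `t`; TT moves to the
twisted line; `brandtXi_le_of_forall` bounds the twisted `ξ` on EVERY setup by the per-setup squeeze
`xi_twist_setup_le` (off rank one `ξ = 0`); `t, [O:O'] ≤ C N^A` keep everything polynomial in `N`.

**Disproof used** (landed `Theorems/XiBound/Negative/*`; the payload `Disproof.lean` is not mounted in
this jail).  `xiBound_violators_infinite` (Locks): every stub is an `∃ A C` statement and no census is
claimed to bear on any of them; `xiBound_iff_forall_setup` / `brandtXi_freyCurve_eq_xi` (DomainSetup):
the composition is per setup and needs no independence of choices (`brandtXi_le_of_forall`); Takahashi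
squeeze `xi_le_modularDegree_mul_ord`: T1·T2 ≥ ξ/(12) ≍ δ_opt/c_r is abc-hard in total — admitted, T2 is
marked hardest, and TT is consistent with it (degrees of twists); value gap `brandtXi_lFunction_ne_one`:
untouched (`ξ ≥ 2` on lines; our `hξpos`).  No stub is an instance of a landed Negative lemma's negation
(`not_xiBound_twoSided_dropParity` concerns lower bounds with the parity guard dropped; we keep all
guards and prove only upper bounds).

crux-plan seat `planner-cruxplan-stmt-ABC-11336-theta-content-squeez-0`, 2026-08-16.
-/

noncomputable section

open scoped BigOperators Pointwise
open Literature.NumberTheory.Automorphic Literature.NumberTheory.EllipticCurves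
open Summit.ABC.ABC.Theses.DefiniteXi

namespace Summit.ABC.ABC.Cruxes.XiBound.ThetaContentSqueeze

/-! ## 1. Abstract lattice layer: pairing, content, congruence exponent, the squeeze lemma -/

section Abstract

variable {ι κ : Type*} [Fintype ι] [Fintype κ]

/-- The Gross pairing against `φ`: `x ↦ ⟨x, φ⟩_w = Σ_i w_i x_i φ_i`. -/
def pairWith (w : ι → ℕ) (φ : ι → ℤ) : (ι → ℤ) →ₗ[ℤ] ℤ where
  toFun x := ∑ i, (w i : ℤ) * x i * φ i
  map_add' x y := by
    simp only [Pi.add_apply]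
    rw [← Finset.sum_add_distrib]
    exact Finset.sum_congr rfl fun i _ => by ring
  map_smul' r x := by
    simp only [Pi.smul_apply, smul_eq_mul, RingHom.id_apply, Finset.mul_sum]
    exact Finset.sum_congr rfl fun i _ => by ring

theorem pairWith_apply (w : ι → ℕ) (φ x : ι → ℤ) :
    pairWith w φ x = ∑ i, (w i : ℤ) * x i * φ i := rfl

/-- The `w`-orthogonal complement `φ^{⊥_w} = {x : ⟨x, φ⟩_w = 0}` (for a Hecke eigen-line: the sum of the
other Hecke packets, the Brandt matrices being `w`-self-adjoint). -/
def perp (w : ι → ℕ) (φ : ι → ℤ) : Submodule ℤ (ι → ℤ) := LinearMap.ker (pairWith w φ)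

theorem mem_perp_iff (w : ι → ℕ) (φ x : ι → ℤ) :
    x ∈ perp w φ ↔ ∑ i, (w i : ℤ) * x i * φ i = 0 := by
  rw [perp, LinearMap.mem_ker, pairWith_apply]

/-- The content (normalised gcd of the coordinates, `≥ 0`) of an integer vector. -/
def content (y : κ → ℤ) : ℤ := Finset.univ.gcd y

/-- The primitive part `y / content(y)` (coordinatewise exact division). -/
def prim (y : κ → ℤ) : κ → ℤ := fun k => y k / content y

theorem content_smul_prim (y : κ → ℤ) : content y • prim y = y := by
  funext k
  simp only [Pi.smul_apply, smul_eq_mul, prim]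
  exact Int.mul_ediv_cancel' (Finset.gcd_dvd (Finset.mem_univ k))

theorem content_eq_zero_iff (y : κ → ℤ) : content y = 0 ↔ y = 0 := by
  rw [content, Finset.gcd_eq_zero_iff]
  constructor
  · intro h
    funext k
    exact h k (Finset.mem_univ k)
  · rintro rfl k -
    rfl

theorem content_nonneg (y : κ → ℤ) : 0 ≤ content y :=
  Int.nonneg_of_normalize_eq_self (Finset.normalize_gcd (s := Finset.univ) (f := y))

/-- The exponent set of `Θ` relative to `φ`: positive `e` with `e · Θx ∈ ℤ·prim(Θφ) + Θ(φ^⊥)` for all `x`. -/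
def expSet (w : ι → ℕ) (φ : ι → ℤ) (Θ : (ι → ℤ) →ₗ[ℤ] (κ → ℤ)) : Set ℕ :=
  {e | 0 < e ∧ ∀ x : ι → ℤ, ∃ a : ℤ, (e : ℤ) • Θ x - a • prim (Θ φ) ∈ (perp w φ).map Θ}

/-- **The congruence exponent `η₀` of the line through `Θφ` inside the theta image**: the least positive
`e` with `e · Θ(X) ⊆ ℤ·prim(Θφ) + Θ(φ^{⊥_w})` (junk `0` if none, which does not happen for `ξ > 0`,
`xi_mem_expSet`). -/
def congrExponent (w : ι → ℕ) (φ : ι → ℤ) (Θ : (ι → ℤ) →ₗ[ℤ] (κ → ℤ)) : ℕ := sInf (expSet w φ Θ)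

/-- `ξ = ⟨φ, φ⟩_w` itself is an exponent: `ξ·x = ⟨x,φ⟩ φ + x''` with `x'' ⊥ φ`. -/
theorem xi_mem_expSet (w : ι → ℕ) (φ : ι → ℤ) (Θ : (ι → ℤ) →ₗ[ℤ] (κ → ℤ))
    (hξ : 0 < ∑ i, (w i : ℤ) * φ i * φ i) :
    (∑ i, (w i : ℤ) * φ i * φ i).toNat ∈ expSet w φ Θ := by
  set ξ : ℤ := ∑ i, (w i : ℤ) * φ i * φ i with hξdef
  have hcast : ((ξ.toNat : ℕ) : ℤ) = ξ := Int.toNat_of_nonneg hξ.le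
  refine ⟨by omega, fun x => ⟨pairWith w φ x * content (Θ φ), ?_⟩⟩
  rw [hcast]
  refine ⟨ξ • x - (pairWith w φ x) • φ, ?_, ?_⟩
  · -- the witness is `w`-orthogonal to `φ`
    rw [SetLike.mem_coe, perp, LinearMap.mem_ker, map_sub, map_smul, map_smul, smul_eq_mul, smul_eq_mul]
    have : pairWith w φ φ = ξ := rfl
    rw [this]
    ring
  · rw [map_sub, map_smul, map_smul]
    congr 1
    conv_lhs => rw [← content_smul_prim (Θ φ)]
    rw [smul_smul, mul_comm]

theorem congrExponent_mem (w : ι → ℕ) (φ : ι → ℤ) (Θ : (ι → ℤ) →ₗ[ℤ] (κ → ℤ))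
    (hξ : 0 < ∑ i, (w i : ℤ) * φ i * φ i) : congrExponent w φ Θ ∈ expSet w φ Θ :=
  Nat.sInf_mem ⟨_, xi_mem_expSet w φ Θ hξ⟩

theorem congrExponent_pos (w : ι → ℕ) (φ : ι → ℤ) (Θ : (ι → ℤ) →ₗ[ℤ] (κ → ℤ))
    (hξ : 0 < ∑ i, (w i : ℤ) * φ i * φ i) : 0 < congrExponent w φ Θ :=
  (congrExponent_mem w φ Θ hξ).1

/-- **`η₀ ∣ ξ` in size: `η₀ ≤ ξ`** — the squeeze never loses: T2 below is implied by the crux. -/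
theorem congrExponent_le (w : ι → ℕ) (φ : ι → ℤ) (Θ : (ι → ℤ) →ₗ[ℤ] (κ → ℤ))
    (hξ : 0 < ∑ i, (w i : ℤ) * φ i * φ i) :
    (congrExponent w φ Θ : ℤ) ≤ ∑ i, (w i : ℤ) * φ i * φ i := by
  have h := Nat.sInf_le (xi_mem_expSet w φ Θ hξ)
  rw [← Int.toNat_of_nonneg hξ.le]
  exact_mod_cast h

omit [Fintype κ] in
/-- Pairing a basis vector: `⟨e_i, φ⟩_w = w_i φ_i`. -/
theorem pairWith_single [DecidableEq ι] (w : ι → ℕ) (φ : ι → ℤ) (i : ι) :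
    pairWith w φ (Pi.single i 1) = (w i : ℤ) * φ i := by
  rw [pairWith_apply]
  have : ∀ j, (w j : ℤ) * (Pi.single i 1 : ι → ℤ) j * φ j = if j = i then (w i : ℤ) * φ i else 0 := by
    intro j
    by_cases h : j = i
    · subst h; simp
    · simp [h]
  rw [Finset.sum_congr rfl fun j _ => this j]
  simp

/-- **The squeeze lemma** (functoriality of congruence exponents; first lemma of the card, here with the
file's canonical `c = content(Θφ)`, `g₀ = prim(Θφ)`, `Yc = Θ(φ^⊥)`, `η₀ = congrExponent`):
if `Θφ ≠ 0` is `ℚ`-disjoint from `Θ(φ^{⊥_w})` then `ξ ∣ η₀ · c · gcd_i(w_i φ_i)`. -/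
theorem xi_dvd_congrExponent_mul_content (w : ι → ℕ) (φ : ι → ℤ) (Θ : (ι → ℤ) →ₗ[ℤ] (κ → ℤ))
    (hξ : 0 < ∑ i, (w i : ℤ) * φ i * φ i)
    (hfree : ∀ a : ℤ, a • Θ φ ∈ (perp w φ).map Θ → a • Θ φ = 0) (hne : Θ φ ≠ 0) :
    (∑ i, (w i : ℤ) * φ i * φ i) ∣
      (congrExponent w φ Θ : ℤ) * content (Θ φ) * Finset.univ.gcd (fun i => (w i : ℤ) * φ i) := by
  classical
  set ξ : ℤ := ∑ i, (w i : ℤ) * φ i * φ i with hξdef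
  set c : ℤ := content (Θ φ) with hcdef
  set g₀ : κ → ℤ := prim (Θ φ) with hg₀def
  set η₀ : ℕ := congrExponent w φ Θ with hη₀def
  have hΘ : Θ φ = c • g₀ := (content_smul_prim (Θ φ)).symm
  have hsplit : ∀ y : ι → ℤ, ∃ a : ℤ, (η₀ : ℤ) • Θ y - a • g₀ ∈ (perp w φ).map Θ :=
    (congrExponent_mem w φ Θ hξ).2
  have hfree' : ∀ a : ℤ, a • g₀ ∈ (perp w φ).map Θ → a = 0 := by
    intro a ha
    have h1 : a • Θ φ ∈ (perp w φ).map Θ := by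
      rw [hΘ, smul_smul, mul_comm, ← smul_smul]
      exact Submodule.smul_mem _ _ ha
    have h2 := hfree a h1
    rcases smul_eq_zero.mp h2 with h | h
    · exact h
    · exact absurd h hne
  let P : (ι → ℤ) → ℤ := fun x => pairWith w φ x
  have hPφ : P φ = ξ := rfl
  -- for every x: ξ ∣ η₀ * c * ⟨x, φ⟩
  have key : ∀ x : ι → ℤ, ξ ∣ (η₀ : ℤ) * c * P x := by
    intro x
    have hx' : ξ • x - (P x) • φ ∈ perp w φ := by
      rw [perp, LinearMap.mem_ker, map_sub, map_smul, map_smul, smul_eq_mul, smul_eq_mul]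
      show ξ * P x - P x * P φ = 0
      rw [hPφ]; ring
    have h1 : Θ (ξ • x - (P x) • φ) ∈ (perp w φ).map Θ := Submodule.mem_map_of_mem hx'
    have h1' : Θ (ξ • x - (P x) • φ) = ξ • Θ x - (P x * c) • g₀ := by
      rw [map_sub, map_smul, map_smul, hΘ, smul_smul]
    obtain ⟨a, ha⟩ := hsplit x
    have h2 : (η₀ : ℤ) • (ξ • Θ x - (P x * c) • g₀) - ξ • ((η₀ : ℤ) • Θ x - a • g₀) ∈ (perp w φ).map Θ :=
      Submodule.sub_mem _ (Submodule.smul_mem _ _ (h1' ▸ h1)) (Submodule.smul_mem _ _ ha)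
    have h3 : (η₀ : ℤ) • (ξ • Θ x - (P x * c) • g₀) - ξ • ((η₀ : ℤ) • Θ x - a • g₀)
        = (ξ * a - (η₀ : ℤ) * (P x * c)) • g₀ := by
      simp only [smul_sub, smul_smul, sub_smul]
      abel_nf
      simp only [mul_comm]
      abel_nf
    have h4 := hfree' _ (h3 ▸ h2)
    exact ⟨a, by linarith [h4]⟩
  have key' : ∀ i, ξ ∣ (η₀ : ℤ) * c * ((w i : ℤ) * φ i) := by
    intro i
    have := key (Pi.single i 1)
    have hP : P (Pi.single i 1) = (w i : ℤ) * φ i := pairWith_single w φ i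
    rwa [hP] at this
  have hdiv : ξ ∣ normalize ((η₀ : ℤ) * c) * Finset.univ.gcd (fun i => (w i : ℤ) * φ i) := by
    rw [← Finset.gcd_mul_left]
    exact Finset.dvd_gcd fun i _ => key' i
  exact ((normalize_associated _).mul_right _).dvd_iff_dvd_right.mp hdiv

omit [Fintype κ] in
/-- **From the divisibility to the bound**: if `φ ≠ 0`, `1 ≤ w_i ≤ W` and `ξ ∣ M · gcd_i(w_i φ_i)` with
`M ≠ 0`, then `ξ ≤ W · M²` (because `gcd² ≤ (w_i φ_i)² ≤ W ξ` at a non-zero coordinate). -/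
theorem sum_le_of_dvd (w : ι → ℕ) (φ : ι → ℤ) (hφ : φ ≠ 0) (hw : ∀ i, 1 ≤ w i) {W : ℕ}
    (hW : ∀ i, w i ≤ W) {M : ℤ} (hM : M ≠ 0)
    (hdvd : (∑ i, (w i : ℤ) * φ i * φ i) ∣ M * Finset.univ.gcd (fun i => (w i : ℤ) * φ i)) :
    (∑ i, (w i : ℤ) * φ i * φ i) ≤ W * M ^ 2 := by
  classical
  set ξ : ℤ := ∑ i, (w i : ℤ) * φ i * φ i with hξdef
  set γ : ℤ := Finset.univ.gcd (fun i => (w i : ℤ) * φ i) with hγdef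
  obtain ⟨i₀, hi₀⟩ : ∃ i, φ i ≠ 0 := Function.ne_iff.mp hφ
  set u : ℤ := (w i₀ : ℤ) * φ i₀ with hudef
  have hw0 : (0 : ℤ) < w i₀ := by exact_mod_cast hw i₀
  have hu : u ≠ 0 := mul_ne_zero hw0.ne' hi₀
  have hterm : ∀ i, 0 ≤ (w i : ℤ) * φ i * φ i := fun i => by
    have : (0 : ℤ) ≤ w i := by exact_mod_cast (Nat.zero_le _)
    nlinarith [sq_nonneg (φ i)]
  have hξu : (w i₀ : ℤ) * φ i₀ * φ i₀ ≤ ξ :=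
    Finset.single_le_sum (f := fun i => (w i : ℤ) * φ i * φ i) (fun i _ => hterm i) (Finset.mem_univ i₀)
  have hξpos : 0 < ξ := lt_of_lt_of_le (by nlinarith [sq_nonneg (φ i₀), sq_pos_of_ne_zero hi₀]) hξu
  -- γ ∣ u, hence |γ| ≤ |u|
  have hγu : γ ∣ u := Finset.gcd_dvd (Finset.mem_univ i₀)
  have hγ0 : γ ≠ 0 := fun h => hu (zero_dvd_iff.mp (h ▸ hγu))
  have hγle : |γ| ≤ |u| := Int.le_of_dvd (abs_pos.mpr hu) ((abs_dvd_abs _ _).mpr hγu)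
  -- ξ ≤ |M| |γ| ≤ |M| |u|
  have h1 : ξ ≤ |M| * |u| := by
    have hMγ : M * γ ≠ 0 := mul_ne_zero hM hγ0
    have := Int.le_of_dvd (abs_pos.mpr hMγ) ((dvd_abs _ _).mpr hdvd)
    rw [abs_mul] at this
    exact this.trans (mul_le_mul_of_nonneg_left hγle (abs_nonneg _))
  -- u² ≤ W ξ
  have h2 : u ^ 2 ≤ W * ξ := by
    have hWi : (w i₀ : ℤ) ≤ W := by exact_mod_cast hW i₀
    calc u ^ 2 = (w i₀ : ℤ) * ((w i₀ : ℤ) * φ i₀ * φ i₀) := by rw [hudef]; ring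
      _ ≤ (W : ℤ) * ((w i₀ : ℤ) * φ i₀ * φ i₀) := mul_le_mul_of_nonneg_right hWi (hterm i₀)
      _ ≤ (W : ℤ) * ξ := mul_le_mul_of_nonneg_left hξu (by exact_mod_cast (Nat.zero_le W))
  -- ξ² ≤ M² u² ≤ M² W ξ
  have h3 : ξ * ξ ≤ (W * M ^ 2) * ξ := by
    have hsq : ξ ^ 2 ≤ (|M| * |u|) ^ 2 := pow_le_pow_left₀ hξpos.le h1 2
    calc ξ * ξ = ξ ^ 2 := (sq ξ).symm
      _ ≤ (|M| * |u|) ^ 2 := hsq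
      _ = M ^ 2 * u ^ 2 := by rw [mul_pow, sq_abs, sq_abs]
      _ ≤ M ^ 2 * (W * ξ) := mul_le_mul_of_nonneg_left h2 (sq_nonneg M)
      _ = (W * M ^ 2) * ξ := by ring
  exact le_of_mul_le_mul_right h3 hξpos

end Abstract

/-! ## 2. The concrete ternary theta data of a Brandt setup and a sub-order -/

section Theta

variable {D : Type*} [Ring D] [Algebra ℚ D]

/-- **Gross lattice** of a `ℤ`-order `R ⊂ D`: `R^T = {2x − trd(x) : x ∈ R}`, the trace-zero part of
`ℤ + 2R` — for an order in a definite quaternion algebra a positive definite integral ternary lattice for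
`nrd` (`nrd(2x − trd x) = 4 nrd x − trd(x)² = −disc x`).  Gross 1987 §12 (the lattices `S_i⁰`, `N⁺ = 1`);
Fung–Kane `𝒪^T = (2𝒪 + ℤ) ∩ B⁰`; Böcherer–Schulze-Pillot for Eichler orders. -/
def grossLattice (R : Submodule ℤ D) : Set D :=
  {h | ∃ x ∈ R, h = (2 : ℤ) • x - algebraMap ℚ D (reducedTrace ℚ D x)}

/-- Vectors of the Gross lattice of `R` of reduced norm exactly `d` (finite for an order in a definite
algebra); its cardinality `r(R^T, d)` is the `d`-th coefficient of the theta series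
`ϑ(R^T) = Σ_{h ∈ R^T} q^{nrd h}` (weight `3/2`; by Gross Prop. 12.9 it counts the embeddings of the
quadratic orders of discriminant `−d/f²` into `R`).  An isometry invariant, so a class function. -/
def repSet (R : Submodule ℤ D) (d : ℕ) : Set D :=
  {h | h ∈ grossLattice R ∧ reducedNorm ℚ D h = d}

variable {Nplus Nminus : ℕ} (S : Brandt.XiSetup Nplus Nminus) (O' : Submodule ℤ S.D)

/-- **Theta coefficient of the class `c` of `S.O` seen through the sub-order `O' ⊆ S.O`**:
`a(c, d) = Σ_{c' ↦ c} (w_c / w'_{c'}) · r(R'_{c'}^T, d)`, the sum over the classes `c'` of invertible right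
`O'`-ideals with `I'_{c'} · O ∼ I_c`, `R'_{c'} = O_L(I'_{c'})`, `w' =` the weights of `O'`.  This is the
`d`-th coefficient of `Θ_{O'}(ρ^! e_c)` where `ρ : Cls O' → Cls O`, `I' ↦ I'O`, and
`ρ^! e_c = Σ_{c' ↦ c} [R_cˣ : R'_{c'}ˣ] e_{c'}` is the pull-back of divisors with multiplicity — the
integral map intertwining the Brandt matrices of `O` and `O'` (`Matrix.mulVec` convention) at
`p ∤ [O : O']·N` (`ρ_* T' = T ρ_*`, self-adjointness for `w` and `w'`).  For `O' = S.O` it is `r(R_c^T, d)`.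
`finsum`: junk `0` if `Cls O'` is infinite (never for an order). -/
def thetaCoeff (c : Brandt.ClassSet S.O) (d : ℕ) : ℤ :=
  open scoped Classical in
  ∑ᶠ c' : Brandt.ClassSet O',
    if ∃ α : (S.D)ˣ, c'.rep * S.O = α • c.rep then
      ((Brandt.weight S.O c / Brandt.weight O' c' : ℕ) : ℤ) * ((repSet (Brandt.leftOrder c'.rep) d).ncard : ℤ)
    else 0

/-- **The (truncated) ternary theta map through `O'`**, `Θ_{S,O',B} : ℤ[Cls O] → ℤ^B`,
`(Θ v)_d = Σ_c v_c · a(c, d)` for `d < B` — the first `B` coefficients of `Σ_{c'} (ρ^! v)_{c'} ϑ(R'_{c'}^T)`.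
`ℤ`-linear by construction; by Eichler's commutation relation (`ϑ(L) | T_{p²} = Σ_{M ∈ Nbr_p(L)} ϑ(M)`,
and the `p + 1` sub-ideals `J ⊆ I'` of index `p²` have as left orders the `p`-neighbours of `O_L(I')`) it
intertwines `T(p)` on `ℤ[Cls O]` with `T_{p²}` on `q`-expansions for every prime `p ∤ 2·[O:O']·N⁺N⁻`. -/
def thetaMap (B : ℕ) : (Brandt.ClassSet S.O → ℤ) →ₗ[ℤ] (Fin B → ℤ) :=
  letI := Fintype.ofFinite (Brandt.ClassSet S.O)
  { toFun := fun v d => ∑ c, v c * thetaCoeff S O' c d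
    map_add' := fun x y => by
      funext d
      simp only [Pi.add_apply, add_mul, Finset.sum_add_distrib]
    map_smul' := fun r x => by
      funext d
      simp only [Pi.smul_apply, smul_eq_mul, RingHom.id_apply, Finset.mul_sum, mul_assoc] }

/-- Admissible auxiliary orders: `ℤ`-orders of `S.D` contained in the Eichler order `S.O` (test vectors
of the theta lift: `O' = S.O` is Gross's choice; finer `O'` change the local Schwartz function at the
primes dividing `[S.O : O']`, e.g. at `2` for non-semistable Frey curves and at the twisting prime). -/
def IsSubOrder : Prop := Brandt.IsOrder S.D O' ∧ O' ≤ S.O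

/-- The index `[S.O : O']` (finite and positive for a sub-order; `AddSubgroup.relIndex`). -/
def subOrderIndex : ℕ := O'.toAddSubgroup.relIndex S.O.toAddSubgroup

end Theta

/-! ## 3. The stubs of the line -/

/-- Auxiliary twisting prime: `t = 1` (no twist) or an odd prime not dividing `2M`. -/
def Admissible (t M : ℕ) : Prop := t = 1 ∨ (t.Prime ∧ ¬ t ∣ 2 * M)

/-- The eigenvalue system of the quadratic twist `E_(a,b) ⊗ χ_t`, `χ_t = (·/t)` the Legendre symbol mod
the odd prime `t` (`= χ_{t*}`, the primitive quadratic character of conductor `t`; Mathlib `jacobiSym`,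
multiplicative in `n`, `χ_1 = 1`): `n ↦ χ_t(n) · a_n(E_(a,b))`.  For `t ∤ 2N` the newform `f_E ⊗ χ_t` has
level `N t²` and is new there, so on the definite algebra of discriminant `N⁻` its Jacquet–Langlands line
lives in the Brandt module of the Eichler order of level `N⁺ t²` (multiplicity one; only `p ∤ N t²` enter). -/
def twistSystem (a b : ℤ) (t : ℕ) : ℕ → ℤ := fun n => jacobiSym (n : ℤ) t * (freyCurve a b).LFunction n

/-- The data of a TWISTED instance together with a generator of its eigen-line: a Frey pair `(a,b)`,
`N = N(E_(a,b))`, an admissible `N⁻ = Nm ∣ N`, an admissible twisting prime `t`, a Brandt setup `S` of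
type `(N/Nm · t², Nm)` and `φ ≠ 0` with `eigenLattice(χ_t · a(E)) = ℤ φ` (`t = 1`: the crux's own line,
in a setup of type `(N/Nm · 1², Nm)`; off rank one there is nothing to prove, `ξ = 0`). -/
def IsFreyTwistLine (a b : ℤ) (N Nm t : ℕ) (S : Brandt.XiSetup (N / Nm * t ^ 2) Nm)
    (φ : Brandt.ClassSet S.O → ℤ) : Prop :=
  letI := Fintype.ofFinite (Brandt.ClassSet S.O)
  IsCoprime a b ∧ a * b * (a + b) ≠ 0 ∧ (freyCurve a b).conductorNorm ℤ = N ∧ Odd Nm ∧ Squarefree Nm ∧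
    Odd Nm.primeFactors.card ∧ Nm ∣ N ∧ Admissible t N ∧ φ ≠ 0 ∧
    Brandt.eigenLattice (N / Nm * t ^ 2 * Nm) (Brandt.matrix S.O) (twistSystem a b t) = ℤ ∙ φ

/-- **Stub W (weights).**  `w_c = #R_cˣ/2 ≤ 12` for every class of every Brandt setup: unit groups of
`ℤ`-orders in definite quaternion algebras over `ℚ` have order dividing `24` (their elements are roots of
unity of degree `≤ 2` over `ℚ`, i.e. of order `1,2,3,4,6`; finite subgroups of `ℍˣ` with these element
orders have order `≤ 24`).  Known (Gross 1987 §1: `w_i ∣ 12`; Vignéras LNM 800 V.3; Voight GTM 288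
§32); the tree has only `Brandt.XiSetup.one_le_weight`.  Needed to absorb the factor
`γ = gcd_c(w_c φ_c)` of the squeeze lemma (`sum_le_of_dvd`). -/
def WeightBound : Prop :=
  ∀ (Nplus Nminus : ℕ) (S : Brandt.XiSetup Nplus Nminus) (c : Brandt.ClassSet S.O), Brandt.weight S.O c ≤ 12

/-- **Stub S (the theta seam).**  For every Hecke eigen-LINE `ℤφ` of every Brandt setup and every
sub-order `O'`, beyond some truncation length `B₀` the theta image of `φ` is `ℚ`-disjoint from the theta
image of `φ^{⊥_w}`: `a · Θφ ∈ Θ(φ^⊥) ⟹ a · Θφ = 0`.  Mechanism: `Θ_{S,O'} = Θ_{O'} ∘ ρ^!` intertwines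
`T(p)` with `T_{p²}` for `p ∤ 2[O:O']N⁺N⁻` (Eichler's commutation relation; `ρ_* T' = T ρ_*`); the Brandt
matrices are `w`-self-adjoint (`w_i T_ij = w_j T_ji`, via `b ↦ p b⁻¹`), so `φ^{⊥_w} ⊗ ℚ` is the sum of the
OTHER joint eigenspaces; joint `T_{p²}`-eigenvectors with pairwise distinct eigen-systems are linearly
independent (two systems of level `N⁺N⁻` agreeing at all `p ∤ 2[O:O']N⁺N⁻` coincide, strong multiplicity
one); a finite-dimensional space of `q`-expansions injects into some truncation.  No bound on `B₀` is
claimed (Sturm would give one).  Sources: Eichler (J. reine angew. Math. 195 (1955)), Schulze-Pillot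
(Invent. Math. 75 (1984); Nagoya Math. J. 102 (1986)), Gross 1987 §§4, 12. -/
def ThetaSeam : Prop :=
  ∀ (Nplus Nminus : ℕ) (S : Brandt.XiSetup Nplus Nminus) (O' : Submodule ℤ S.D) (lam : ℕ → ℤ)
    (φ : Brandt.ClassSet S.O → ℤ),
    letI := Fintype.ofFinite (Brandt.ClassSet S.O)
    IsSubOrder S O' → φ ≠ 0 → Brandt.eigenLattice (Nplus * Nminus) (Brandt.matrix S.O) lam = ℤ ∙ φ →
    ∃ B₀ : ℕ, ∀ B : ℕ, B₀ ≤ B →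
      ∀ a : ℤ, a • thetaMap S O' B φ ∈ (perp (Brandt.weight S.O) φ).map (thetaMap S O' B) →
        a • thetaMap S O' B φ = 0

/-- **Stub TT (twist transfer).**  The definite congruence number grows at most polynomially under an
admissible quadratic twist: `ξ(f_E; N⁺, N⁻) ≤ C (N t)^A · ξ(f_E ⊗ χ_t; N⁺t², N⁻)` (`t = 1`: equality).
Mechanism: both sides are optimal modular degrees up to polynomial factors — `ξ ≤ δ_opt · c_r`
(Negative/XiBoundTakahashiSqueeze from `takahashi2001_thm_2_3`), `δ_opt(E^{(t)}) ≤ κ ξ(f⊗χ_t) ∏_{q∣N⁻} c_q`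
(Takahashi 2001 Thm 2.3/3.8, Ribet–Takahashi, Pollack–Weston 2011 Thm 6.8 — to be EXTENDED to the additive
level `t²`, same local-at-`q` proofs), `δ_opt(E) ≤ K δ_opt(E^{(t)})` (Zagier `4π²c²(f,f) = deg · covol`,
`covol(E^{(t)}) ≍ covol(E)/t`, `(f_χ, f_χ) ≍ t^{2+o(1)} (f,f)` by Rankin–Selberg), `c_q(E^{(t)}) = c_q(E)`.
Alternatively: this file's squeeze lemma for the integral twisting operator
`R_χ = Σ_u χ(u)[n_u] : ℤ[Cls O_{N⁺}] → ℤ[Cls O_{N⁺t²}]` (needs a `t`-adic splitting).  Known-type, with the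
route's Eisenstein-prime corner (`ℓ = 2, 3`) as caveat; NOT abc-strength. -/
def TwistTransfer : Prop :=
  ∃ A C : ℕ, ∀ (a b : ℤ) (N Nm : ℕ), IsCoprime a b → a * b * (a + b) ≠ 0 →
    (freyCurve a b).conductorNorm ℤ = N → Odd Nm → Squarefree Nm → Odd Nm.primeFactors.card → Nm ∣ N →
    ∀ t : ℕ, Admissible t N →
      brandtXi (N / Nm) Nm (fun n => (freyCurve a b).LFunction n) ≤
        C * (N * t) ^ A * brandtXi (N / Nm * t ^ 2) Nm (twistSystem a b t)

/-- **Stub NV (non-vanishing with a polynomial twist, test order and index).**  For every instance of the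
crux there is an admissible `t ≤ C N^A` such that on every eigen-line `φ` of the twist `χ_t · a(E)` (type
`(N/Nm·t², Nm)`) some sub-order `O'` of index `≤ C N^A` and some index `d ≤ C N^A` give
`(Θ_{S,O'} φ)_d ≠ 0`.  Mechanism: `(Θφ)_d` is a toric (CM) period of `φ_{f⊗χ_t}` over the CM points of
discriminant `−d`; the global theta lift of `π_f ⊗ χ_t` from the definite algebra to weight `3/2` is
non-zero iff `L(f⊗χ_t, 1) ≠ 0` (Waldspurger 1981/1991; Gross 1987 §13 and Böcherer–Schulze-Pillot
1990/1991 for the test vectors `1_{R^T}` at squarefree level), every `π_v` lifts locally (split `v`: always;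
ramified `v`: both members of the Waldspurger packet exist); `t = 1` works iff `L(E,1) ≠ 0`, otherwise take
the least `t` with `L(E⊗χ_t,1) ≠ 0` (Friedberg–Hoffstein 1995; polynomial in `N` by first-moment
asymptotics of quadratic twists with polynomial level dependence), the sub-order `O'` supplies test vectors
at `2` (additive reduction, level `2^k`, `k ≤ 8`) and at `t` (level `t²`) where `1_{R^T}` of the Eichler
order is not known to work, and `d ≤` Sturm bound of the resulting weight-3/2 level.  XL; the local
test-vector computations at `2` and `t` are the line's honest definition risk. -/
def ThetaNonvanishing : Prop :=
  ∃ A C : ℕ, ∀ (a b : ℤ) (N Nm : ℕ), IsCoprime a b → a * b * (a + b) ≠ 0 →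
    (freyCurve a b).conductorNorm ℤ = N → Odd Nm → Squarefree Nm → Odd Nm.primeFactors.card → Nm ∣ N →
    ∃ t : ℕ, Admissible t N ∧ t ≤ C * N ^ A ∧
      ∀ (S : Brandt.XiSetup (N / Nm * t ^ 2) Nm) (φ : Brandt.ClassSet S.O → ℤ),
        IsFreyTwistLine a b N Nm t S φ →
        ∃ (O' : Submodule ℤ S.D) (d : ℕ), IsSubOrder S O' ∧ subOrderIndex S O' ≤ C * N ^ A ∧
          d ≤ C * N ^ A ∧ ∀ (B : ℕ) (hd : d < B), thetaMap S O' B φ ⟨d, hd⟩ ≠ 0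

/-- **Stub T1 (theta-content bound).**  Beyond a polynomial truncation length (the Sturm bound of the
weight-3/2 space of level `4·lcm(N t², [O:O']-part)`: the content of a truncation then equals the content
of the whole expansion by the `q`-expansion principle), the content `c = gcd_d (Θφ)_d` of the theta image
of a twisted Frey line through a sub-order of index `m` is `≤ C (N t m)^A`.  Meaning: `ℓ ∣ c` iff
`φ mod ℓ` is `w`-orthogonal to ALL the CM cycles seen by `O'` ("theta-degeneracy primes"; by Gross's
formula `c² ≐ Ш · ∏_{q ∣ N⁺} c_q · gcd_D L^{alg}(E^{(D)},1)` up to Eisenstein primes).  Handles: CM cycles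
generate mod `ℓ` (Vatsal 2002, Cornut–Vatsal 2005), Emerton-type saturation of theta maps.  Implied by
the crux (`c ≤ |first non-zero coefficient| ≤ √ξ · poly`, first index `≤` Sturm bound); unknown. -/
def ThetaContentBound : Prop :=
  ∃ A C : ℕ, ∀ (a b : ℤ) (N Nm t : ℕ) (S : Brandt.XiSetup (N / Nm * t ^ 2) Nm)
    (φ : Brandt.ClassSet S.O → ℤ) (O' : Submodule ℤ S.D), IsFreyTwistLine a b N Nm t S φ → IsSubOrder S O' →
    ∀ B : ℕ, C * (N * t * subOrderIndex S O') ^ A ≤ B →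
      (content (thetaMap S O' B φ)).natAbs ≤ C * (N * t * subOrderIndex S O') ^ A

/-- **Stub T2 (half-integral congruence-exponent bound) — the load-bearing stub.**  Beyond a polynomial
truncation length, the congruence exponent `η₀` of the primitive theta vector `Θφ/c` inside the theta
image `Θ(X)` relative to `Θ(φ^{⊥_w})` is `≤ C (N t m)^A`.  Always `η₀ ≤ ξ` (`congrExponent_le`), and
`ξ ∣ η₀ · c · γ` (`xi_dvd_congrExponent_mul_content`), so given T1 and W this IS the crux read in the
weight-3/2 lattice — abc-strength, admittedly (triage r1-2 / r1-3; Negative/XiBoundTakahashiSqueeze).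
What the transfer exposes: `η₀` is a congruence, modulo prime powers, between INTEGER vectors of length
`≍` Sturm bound whose entries are CM periods — square roots of algebraic central values of the quadratic
twists `E^{(−d)}` (Gross, Kohnen–Zagier, Baruch–Mao) — and the corresponding vectors of the other
`N⁻`-new packets; it is decided below the Sturm bound by the `q`-expansion principle, a handle with no
analogue for `ξ` on the self-dual lattice `X`. -/
def ThetaCongruenceExponentBound : Prop :=
  ∃ A C : ℕ, ∀ (a b : ℤ) (N Nm t : ℕ) (S : Brandt.XiSetup (N / Nm * t ^ 2) Nm)
    (φ : Brandt.ClassSet S.O → ℤ) (O' : Submodule ℤ S.D), IsFreyTwistLine a b N Nm t S φ → IsSubOrder S O' →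
    ∀ B : ℕ, C * (N * t * subOrderIndex S O') ^ A ≤ B →
      letI := Fintype.ofFinite (Brandt.ClassSet S.O)
      congrExponent (Brandt.weight S.O) φ (thetaMap S O' B) ≤ C * (N * t * subOrderIndex S O') ^ A

theorem stub_weightBound : WeightBound := by
  sorry

theorem stub_thetaSeam : ThetaSeam := by
  sorry

theorem stub_twistTransfer : TwistTransfer := by
  sorry

theorem stub_thetaNonvanishing : ThetaNonvanishing := by
  sorry

theorem stub_thetaContentBound : ThetaContentBound := by
  sorry

theorem stub_thetaCongruenceExponentBound : ThetaCongruenceExponentBound := by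
  sorry

/-! ### Names for the six statements (hypotheses of the composition)

The skeleton audit admits, as hypotheses of the theorem that concludes the crux, only registered obligations or the
declared stubs BY NAME; `Statement.stub_x` is the statement of `stub_x` under the stub's own short name, so that
`XiBound_of` is stated over the six statements and passes `#h21_check_skeleton`. -/

namespace Statement

/-- Statement of `stub_weightBound` (W). -/
abbrev stub_weightBound : Prop := type_of% ThetaContentSqueeze.stub_weightBound
/-- Statement of `stub_thetaSeam` (S). -/
abbrev stub_thetaSeam : Prop := type_of% ThetaContentSqueeze.stub_thetaSeam
/-- Statement of `stub_twistTransfer` (TT). -/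
abbrev stub_twistTransfer : Prop := type_of% ThetaContentSqueeze.stub_twistTransfer
/-- Statement of `stub_thetaNonvanishing` (NV). -/
abbrev stub_thetaNonvanishing : Prop := type_of% ThetaContentSqueeze.stub_thetaNonvanishing
/-- Statement of `stub_thetaContentBound` (T1). -/
abbrev stub_thetaContentBound : Prop := type_of% ThetaContentSqueeze.stub_thetaContentBound
/-- Statement of `stub_thetaCongruenceExponentBound` (T2). -/
abbrev stub_thetaCongruenceExponentBound : Prop := type_of% ThetaContentSqueeze.stub_thetaCongruenceExponentBound

end Statement

/-! ## 4. Composition: the stubs imply the crux, by name -/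

/-- Per-setup bound on the TWISTED side: on every setup of type `(N/Nm·t², Nm)`, seam + non-vanishing +
T1 + T2 + W bound `ξ(f_E ⊗ χ_t)` polynomially in `N t m`, `m ≤ C₀ N^{D₀}` the index of the test order. -/
theorem xi_twist_setup_le (hW : WeightBound) (hS : ThetaSeam) {C₀ D₀ A₁ C₁ A₂ C₂ : ℕ}
    {a b : ℤ} {N Nm t : ℕ}
    (hNV : ∀ (S : Brandt.XiSetup (N / Nm * t ^ 2) Nm) (φ : Brandt.ClassSet S.O → ℤ),
      IsFreyTwistLine a b N Nm t S φ →
        ∃ (O' : Submodule ℤ S.D) (d : ℕ), IsSubOrder S O' ∧ subOrderIndex S O' ≤ C₀ * N ^ D₀ ∧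
          d ≤ C₀ * N ^ D₀ ∧ ∀ (B : ℕ) (hd : d < B), thetaMap S O' B φ ⟨d, hd⟩ ≠ 0)
    (hT1 : ∀ (S : Brandt.XiSetup (N / Nm * t ^ 2) Nm) (φ : Brandt.ClassSet S.O → ℤ)
      (O' : Submodule ℤ S.D), IsFreyTwistLine a b N Nm t S φ → IsSubOrder S O' →
      ∀ B : ℕ, C₁ * (N * t * subOrderIndex S O') ^ A₁ ≤ B →
        (content (thetaMap S O' B φ)).natAbs ≤ C₁ * (N * t * subOrderIndex S O') ^ A₁)
    (hT2 : ∀ (S : Brandt.XiSetup (N / Nm * t ^ 2) Nm) (φ : Brandt.ClassSet S.O → ℤ)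
      (O' : Submodule ℤ S.D), IsFreyTwistLine a b N Nm t S φ → IsSubOrder S O' →
      ∀ B : ℕ, C₂ * (N * t * subOrderIndex S O') ^ A₂ ≤ B →
        letI := Fintype.ofFinite (Brandt.ClassSet S.O)
        congrExponent (Brandt.weight S.O) φ (thetaMap S O' B) ≤ C₂ * (N * t * subOrderIndex S O') ^ A₂)
    (hab : IsCoprime a b) (h0 : a * b * (a + b) ≠ 0) (hN : (freyCurve a b).conductorNorm ℤ = N)
    (h1 : Odd Nm) (h2 : Squarefree Nm) (h3 : Odd Nm.primeFactors.card) (h4 : Nm ∣ N)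
    (ht : Admissible t N) (S : Brandt.XiSetup (N / Nm * t ^ 2) Nm) :
    S.xi (twistSystem a b t) ≤ 12 * (C₁ * C₂) ^ 2 * (N * t * (C₀ * N ^ D₀)) ^ (2 * (A₁ + A₂)) := by
  classical
  letI : Fintype (Brandt.ClassSet S.O) := Fintype.ofFinite _
  rw [Brandt.XiSetup.xi, Brandt.xiOfOrder_eq]
  by_cases hline : ∃ φ : Brandt.ClassSet S.O → ℤ, φ ≠ 0 ∧
      Brandt.eigenLattice (N / Nm * t ^ 2 * Nm) (Brandt.matrix S.O) (twistSystem a b t) = ℤ ∙ φ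
  swap
  · rw [Brandt.xi_of_not_isLine _ hline]
    exact Nat.zero_le _
  obtain ⟨φ, hφ, hL⟩ := hline
  rw [Brandt.xi_eq_sum _ hφ hL]
  set w : Brandt.ClassSet S.O → ℕ := Brandt.weight S.O with hwdef
  have hFL : IsFreyTwistLine a b N Nm t S φ := ⟨hab, h0, hN, h1, h2, h3, h4, ht, hφ, hL⟩
  -- non-vanishing: the test order `O'` and the index `d`
  obtain ⟨O', d, hO', hidx, hdle, hcoef⟩ := hNV S φ hFL
  set m : ℕ := subOrderIndex S O' with hmdef
  -- the seam beyond `B₀`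
  obtain ⟨B₀, hB₀⟩ := hS (N / Nm * t ^ 2) Nm S O' (twistSystem a b t) φ hO' hφ hL
  -- the truncation length
  set B : ℕ := max (max B₀ (d + 1)) (max (C₁ * (N * t * m) ^ A₁) (C₂ * (N * t * m) ^ A₂)) with hBdef
  have hBB₀ : B₀ ≤ B := (le_max_left _ _).trans (le_max_left _ _)
  have hdB : d < B := lt_of_lt_of_le (Nat.lt_succ_self d) ((le_max_right _ _).trans (le_max_left _ _))
  have hB1 : C₁ * (N * t * m) ^ A₁ ≤ B := (le_max_left _ _).trans (le_max_right _ _)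
  have hB2 : C₂ * (N * t * m) ^ A₂ ≤ B := (le_max_right _ _).trans (le_max_right _ _)
  set Θ := thetaMap S O' B with hΘdef
  -- Θ φ ≠ 0
  have hne : Θ φ ≠ 0 := by
    intro h
    exact hcoef B hdB (by rw [← hΘdef, h]; rfl)
  -- ξ > 0
  have hw1 : ∀ c, 1 ≤ w c := fun c => S.one_le_weight c
  have hterm : ∀ c, 0 ≤ (w c : ℤ) * φ c * φ c := fun c => by
    have : (0 : ℤ) ≤ w c := by exact_mod_cast (Nat.zero_le _)
    nlinarith [sq_nonneg (φ c)]
  have hξpos : 0 < ∑ c, (w c : ℤ) * φ c * φ c := by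
    obtain ⟨c₀, hc₀⟩ : ∃ c, φ c ≠ 0 := Function.ne_iff.mp hφ
    have hw0 : (0 : ℤ) < w c₀ := by exact_mod_cast hw1 c₀
    have hlt : 0 < (w c₀ : ℤ) * φ c₀ * φ c₀ := by nlinarith [sq_pos_of_ne_zero hc₀]
    exact lt_of_lt_of_le hlt
      (Finset.single_le_sum (f := fun c => (w c : ℤ) * φ c * φ c) (fun c _ => hterm c) (Finset.mem_univ c₀))
  -- the squeeze lemma
  have hfree : ∀ a' : ℤ, a' • Θ φ ∈ (perp w φ).map Θ → a' • Θ φ = 0 := hB₀ B hBB₀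
  have hdvd := xi_dvd_congrExponent_mul_content w φ Θ hξpos hfree hne
  set η₀ : ℕ := congrExponent w φ Θ with hη₀def
  set cc : ℤ := content (Θ φ) with hccdef
  have hη₀pos : 0 < η₀ := congrExponent_pos w φ Θ hξpos
  have hcc0 : cc ≠ 0 := fun h => hne ((content_eq_zero_iff _).mp h)
  set M : ℤ := (η₀ : ℤ) * cc with hMdef
  have hM0 : M ≠ 0 := mul_ne_zero (by exact_mod_cast hη₀pos.ne') hcc0
  have hdvd' : (∑ c, (w c : ℤ) * φ c * φ c) ∣ M * Finset.univ.gcd (fun c => (w c : ℤ) * φ c) := by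
    simpa only [hMdef, mul_assoc] using hdvd
  have hW12 : ∀ c, w c ≤ 12 := fun c => hW _ _ S c
  have hξle : (∑ c, (w c : ℤ) * φ c * φ c) ≤ 12 * M ^ 2 := by
    have := sum_le_of_dvd w φ hφ hw1 hW12 hM0 hdvd'
    exact_mod_cast this
  -- the two polynomial bounds
  have hc_le : cc.natAbs ≤ C₁ * (N * t * m) ^ A₁ := hT1 S φ O' hFL hO' B hB1
  have hη_le : η₀ ≤ C₂ * (N * t * m) ^ A₂ := hT2 S φ O' hFL hO' B hB2
  -- assemble in ℕ
  have hMabs : M.natAbs ≤ C₂ * (N * t * m) ^ A₂ * (C₁ * (N * t * m) ^ A₁) := by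
    rw [hMdef, Int.natAbs_mul, Int.natAbs_natCast]
    exact Nat.mul_le_mul hη_le hc_le
  have hsum_cast : ((∑ c, w c * (φ c).natAbs ^ 2 : ℕ) : ℤ) = ∑ c, (w c : ℤ) * φ c * φ c := by
    push_cast
    refine Finset.sum_congr rfl fun c _ => ?_
    rw [sq_abs]; ring
  have hnat : (∑ c, w c * (φ c).natAbs ^ 2) ≤ 12 * M.natAbs ^ 2 := by
    have h12 : (∑ c, (w c : ℤ) * φ c * φ c) ≤ ((12 * M.natAbs ^ 2 : ℕ) : ℤ) := by
      push_cast
      rw [sq_abs]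
      exact hξle
    rw [← hsum_cast] at h12
    exact_mod_cast h12
  have hmle : N * t * m ≤ N * t * (C₀ * N ^ D₀) := Nat.mul_le_mul_left _ hidx
  calc (∑ c, w c * (φ c).natAbs ^ 2)
      ≤ 12 * M.natAbs ^ 2 := hnat
    _ ≤ 12 * (C₂ * (N * t * m) ^ A₂ * (C₁ * (N * t * m) ^ A₁)) ^ 2 := by gcongr
    _ = 12 * (C₁ * C₂) ^ 2 * (N * t * m) ^ (2 * (A₁ + A₂)) := by ring
    _ ≤ 12 * (C₁ * C₂) ^ 2 * (N * t * (C₀ * N ^ D₀)) ^ (2 * (A₁ + A₂)) := by gcongr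

/-- **`XiBound_of` — the line closes the crux by name.**  The six registered stubs imply
`Summit.ABC.ABC.Theses.DefiniteXi.XiBound`: for an instance `(a,b,N,Nm)`, NV picks the twist `t ≤ C₀N^{D₀}`;
TT bounds `ξ(f_E; N/Nm, Nm)` by `C_T (Nt)^{A_T} · ξ(f_E ⊗ χ_t; N/Nm·t², Nm)`; the latter is bounded on
EVERY setup (`brandtXi_le_of_forall`: no existence or independence of setups is needed) by the per-setup
squeeze `xi_twist_setup_le`; `t, m ≤ C₀ N^{D₀}` make everything polynomial in `N`. -/
theorem XiBound_of (hW : Statement.stub_weightBound) (hS : Statement.stub_thetaSeam)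
    (hTT : Statement.stub_twistTransfer) (hNV : Statement.stub_thetaNonvanishing)
    (hT1 : Statement.stub_thetaContentBound) (hT2 : Statement.stub_thetaCongruenceExponentBound) :
    Summit.ABC.ABC.Theses.DefiniteXi.XiBound := by
  obtain ⟨A_T, C_T, hTT⟩ := hTT
  obtain ⟨D₀, C₀, hNV⟩ := hNV
  obtain ⟨A₁, C₁, hT1⟩ := hT1
  obtain ⟨A₂, C₂, hT2⟩ := hT2
  -- final constants (natural numbers)
  set E : ℕ := 2 * (A₁ + A₂) with hE
  set K : ℕ := C_T * (12 * (C₁ * C₂) ^ 2) * C₀ ^ (A_T + 2 * E) with hK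
  set M : ℕ := (D₀ + 1) * A_T + (2 * D₀ + 1) * E with hM
  refine ⟨(M : ℝ), (K : ℝ), ?_⟩
  intro a b hab h0 N _ hN Nm h1 h2 h3 h4
  -- the integer bound
  have key : brandtXi (N / Nm) Nm (fun n => (freyCurve a b).LFunction n) ≤ K * N ^ M := by
    obtain ⟨t, ht, htle, hNVt⟩ := hNV a b N Nm hab h0 hN h1 h2 h3 h4
    have h_tt := hTT a b N Nm hab h0 hN h1 h2 h3 h4 t ht
    have h_tw : brandtXi (N / Nm * t ^ 2) Nm (twistSystem a b t) ≤
        12 * (C₁ * C₂) ^ 2 * (N * t * (C₀ * N ^ D₀)) ^ E :=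
      brandtXi_le_of_forall fun S =>
        xi_twist_setup_le hW hS hNVt
          (fun S φ O' hFL hO' B hB => hT1 a b N Nm t S φ O' hFL hO' B hB)
          (fun S φ O' hFL hO' B hB => hT2 a b N Nm t S φ O' hFL hO' B hB) hab h0 hN h1 h2 h3 h4 ht S
    calc brandtXi (N / Nm) Nm (fun n => (freyCurve a b).LFunction n)
        ≤ C_T * (N * t) ^ A_T * brandtXi (N / Nm * t ^ 2) Nm (twistSystem a b t) := h_tt
      _ ≤ C_T * (N * t) ^ A_T * (12 * (C₁ * C₂) ^ 2 * (N * t * (C₀ * N ^ D₀)) ^ E) := by gcongr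
      _ ≤ C_T * (N * (C₀ * N ^ D₀)) ^ A_T *
            (12 * (C₁ * C₂) ^ 2 * (N * (C₀ * N ^ D₀) * (C₀ * N ^ D₀)) ^ E) := by gcongr
      _ = K * N ^ M := by rw [hK, hM]; ring
  calc (brandtXi (N / Nm) Nm (fun n => (freyCurve a b).LFunction n) : ℝ)
      ≤ ((K * N ^ M : ℕ) : ℝ) := by exact_mod_cast key
    _ = (K : ℝ) * (N : ℝ) ^ (M : ℝ) := by
        rw [Real.rpow_natCast]
        push_cast
        ring

/-- The crux along this line, MODULO the six registered stubs (references every `stub_*`, so the skeleton audit shows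
exactly which sorries `XiBound` still depends on along this line; a lead closes the crux by discharging them — this
declaration closes nothing and lives in a workfile). -/
theorem XiBound_along_line : Summit.ABC.ABC.Theses.DefiniteXi.XiBound :=
  XiBound_of stub_weightBound stub_thetaSeam stub_twistTransfer stub_thetaNonvanishing stub_thetaContentBound
    stub_thetaCongruenceExponentBound

end Summit.ABC.ABC.Cruxes.XiBound.ThetaContentSqueeze
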